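import Mathlib
import Summits.AtomisticToContinuum.FouriersLaw.Theses.JunctionLocality

/-!
# STRATEGY-CENSUS (generation s1) — typed companion, crux `SuperadditiveResistance`
# (stmt-AtomisticToContinuum-11748)

Crux-strategist seat `planner-cstrat-stmt-AtomisticToContinuum-11748-s1-0`, 2026-08-17.
Kernel-checked forms of the NEW Strengthen / Decomposition / Negation attempts recorded in
`Cruxes/SuperadditiveResistance/STRATEGY-CENSUS.md` §S1.  Nothing here is filed as an item.
`sorry`-free.  The shell `Shell`, `InsertionBounded` are verbatim those of `StrategyCensus.lean`
(seat p1-0) so that `crux_eq_shell` is `Iff.rfl`.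

Contents
* §0 shell and read-back;
* §1 S⁺₄ `IncrementDomination` ("no creep against later one-site increments") ⟹ (A) — with NO shape
  hypothesis (the shape piece of the p1-0 split Σ_f is superfluous), and (A) ⇏ S⁺₄ (parity witness);
* §2 S⁺₅ `IncrementSummable` (summable deviation of one-site increments from a resistivity) ⟹
  bounded affine deviation ⟹ (A);
* §3 Negation: the square-root creep `R_N = ℓN + a + b√N` (finite-size conductivity deficit
  `κ - κ_N ≍ N^{-1/2}`) kills (A) — what an in-box counterexample must look like;
* §4 Decomposition Σ_h: the geometry split balanced/lopsided is GENUINE — a single-spike witness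
  (integer core by `omega` over 27 cases) satisfying (A) with `C = 0` on all balanced pairs while the
  lopsided contact pair `(N₀, 2)` has defect `H·N₀`.
-/

noncomputable section

open MeasureTheory Filter Topology
open Literature.MathematicalPhysics.KineticTheory.HeatConduction

namespace Summit.AtomisticToContinuum.FouriersLaw.Cruxes.SuperadditiveResistance.StrategyCensusS1

/-! ## §0 Shell and read-back (verbatim p1-0) -/

/-- The crux's quantifier prefix applied to an arbitrary conclusion `P` about the response sequence. -/
def Shell (P : (ℕ → ℝ) → Prop) : Prop :=
  ∀ ω₂ lam β γ : ℝ, 0 < ω₂ → 0 < lam → 0 < β → 0 < γ →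
    (∀ (N : ℕ) (T_L T_R : ℝ), 0 < T_L → 0 < T_R → ∀ μ ν : Measure (PhaseSpace N),
      (pinnedChain ω₂ lam β γ).IsSteadyState N T_L T_R μ →
      (pinnedChain ω₂ lam β γ).IsSteadyState N T_L T_R ν → μ = ν) →
    ∀ μ : (N : ℕ) → ℝ → ℝ → Measure (PhaseSpace N),
      (∀ (N : ℕ) (T_L T_R : ℝ), 0 < T_L → 0 < T_R →
        (pinnedChain ω₂ lam β γ).IsSteadyState N T_L T_R (μ N T_L T_R)) →
      ∀ T : ℝ, 0 < T → ∀ D : ℕ → ℝ,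
        (∀ N : ℕ, Tendsto (fun δ : ℝ =>
            (pinnedChain ω₂ lam β γ).totalCurrent (μ N (T + δ / 2) (T - δ / 2)) / δ)
          (𝓝[≠] 0) (𝓝 (D N))) →
        (∀ N : ℕ, 2 ≤ N → 0 < D N) → P D

/-- Resistance `R_N = (N-1)/D_N`. -/
def R (D : ℕ → ℝ) (N : ℕ) : ℝ := ((N : ℝ) - 1) / D N

/-- One-site increment `i_K = R_{K+1} - R_K` (marginal resistance of one more site). -/
def incr (D : ℕ → ℝ) (K : ℕ) : ℝ := R D (K + 1) - R D K

/-- (A) for a sequence: bounded insertion cost (verbatim the crux's conclusion). -/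
def InsertionBounded (D : ℕ → ℝ) : Prop :=
  ∃ C : ℝ, ∀ N M : ℕ, 2 ≤ N → 2 ≤ M →
    ((N : ℝ) - 1) / D N + ((M : ℝ) - 1) / D M - C ≤ ((N : ℝ) + (M : ℝ) - 1) / D (N + M)

/-- Read-back: the crux is `Shell InsertionBounded` (definitional). -/
theorem crux_eq_shell :
    Summit.AtomisticToContinuum.FouriersLaw.Theses.JunctionLocality.SuperadditiveResistance ↔
      Shell InsertionBounded :=
  Iff.rfl

theorem shell_mono {P Q : (ℕ → ℝ) → Prop} (hPQ : ∀ D, P D → Q D) (h : Shell P) : Shell Q :=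
  fun ω₂ lam β γ hω hl hβ hγ hU μ hμ T hT D hD hpos =>
    hPQ D (h ω₂ lam β γ hω hl hβ hγ hU μ hμ T hT D hD hpos)

/-- `InsertionBounded` in `R`-notation. -/
theorem insertionBounded_iff_R (D : ℕ → ℝ) :
    InsertionBounded D ↔ ∃ C : ℝ, ∀ N M : ℕ, 2 ≤ N → 2 ≤ M → R D N + R D M - C ≤ R D (N + M) := by
  unfold InsertionBounded R
  constructor
  · rintro ⟨C, hC⟩
    refine ⟨C, fun N M hN hM => ?_⟩
    have := hC N M hN hM
    push_cast
    linarith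
  · rintro ⟨C, hC⟩
    refine ⟨C, fun N M hN hM => ?_⟩
    have := hC N M hN hM
    push_cast at this
    linarith

/-- Telescoping: `R_{M+N} - R_M = Σ_{k<N} i_{M+k}`. -/
theorem R_add_sub_eq_sum (D : ℕ → ℝ) (M N : ℕ) :
    R D (M + N) - R D M = ∑ k ∈ Finset.range N, incr D (M + k) := by
  induction N with
  | zero => simp
  | succ n ih =>
      rw [Finset.sum_range_succ, ← ih]
      unfold incr
      rw [show M + (n + 1) = M + n + 1 by ring]
      ring

/-! ## §1 S⁺₄ — INCREMENT DOMINATION ("no creep"): `R_N ≤ N·i_K + B` for all `K ≥ N ≥ 2` -/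

/-- S⁺₄ `IncrementDomination`: the resistance of the `N`-chain is at most `N` times ANY later
one-site increment, plus a constant: `∃ B, ∀ 2 ≤ N ≤ K, R_N - N·(R_{K+1} - R_K) ≤ B`.
(Letting `K → ∞` it contains the rate statement `R_N ≤ ℓN + B`, `ℓ = lim inf i_K`.) -/
def IncrementDomination (D : ℕ → ℝ) : Prop :=
  ∃ B : ℝ, ∀ N K : ℕ, 2 ≤ N → N ≤ K → R D N - N * incr D K ≤ B

/-- **S⁺₄ ⟹ (A), with the same constant and NO concavity / shape hypothesis.**
Proof: for `N ≤ M`, `R_{N+M} - R_M` is a sum of `N` increments `i_k`, `M ≤ k < N+M`; bound each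
below by the smallest of them, `i_{K*}` with `K* ≥ M ≥ N`, and apply domination at `(N, K*)`. -/
theorem insertionBounded_of_incrementDomination {D : ℕ → ℝ} (h : IncrementDomination D) :
    InsertionBounded D := by
  obtain ⟨B, hB⟩ := h
  rw [insertionBounded_iff_R]
  -- the asymmetric statement for N ≤ M
  have key : ∀ N M : ℕ, 2 ≤ N → N ≤ M → R D N + R D M - B ≤ R D (N + M) := by
    intro N M hN hNM
    have hne : (Finset.range N).Nonempty := ⟨0, by simp; omega⟩
    obtain ⟨k₀, hk₀, hmin⟩ := Finset.exists_min_image (Finset.range N) (fun k => incr D (M + k)) hne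
    have hsum : (N : ℝ) * incr D (M + k₀) ≤ R D (M + N) - R D M := by
      rw [R_add_sub_eq_sum]
      calc (N : ℝ) * incr D (M + k₀) = ∑ _k ∈ Finset.range N, incr D (M + k₀) := by
            simp [Finset.sum_const, Finset.card_range]
        _ ≤ ∑ k ∈ Finset.range N, incr D (M + k) := Finset.sum_le_sum fun k hk => hmin k hk
    have hdom := hB N (M + k₀) hN (by omega)
    rw [show N + M = M + N by ring]
    linarith
  refine ⟨B, fun N M hN hM => ?_⟩
  rcases le_total N M with hNM | hMN
  · exact key N M hN hNM
  · have := key M N hM hMN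
    rw [show N + M = M + N by ring]
    linarith

theorem crux_of_incrementDomination (h : Shell IncrementDomination) :
    Summit.AtomisticToContinuum.FouriersLaw.Theses.JunctionLocality.SuperadditiveResistance :=
  crux_eq_shell.mpr (shell_mono (fun _ => insertionBounded_of_incrementDomination) h)

/-- **(A) ⇏ S⁺₄: the parity witness.**  `R_N = N + (-1)^N` (i.e. `D_N = (N-1)/(N + (-1)^N)`,
positive for `N ≥ 2`) has bounded insertion cost (`C = 3`) but its increments oscillate by `±2`,
so `R_N - N·i_K = 2N + O(1)` along odd `K`: increment domination fails.  S⁺₄ is therefore STRICTLY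
stronger than (A): it forbids `O(1)` parity oscillation of the contact correction. -/
theorem parityWitness_insertionBounded_not_incrementDomination :
    ∃ D : ℕ → ℝ, (∀ N : ℕ, 2 ≤ N → 0 < D N) ∧ InsertionBounded D ∧ ¬ IncrementDomination D := by
  refine ⟨fun N => ((N : ℝ) - 1) / ((N : ℝ) + (-1) ^ N), ?_, ?_, ?_⟩
  · intro N hN
    have hN' : (2 : ℝ) ≤ N := by exact_mod_cast hN
    have h1 : (-1 : ℝ) ≤ (-1) ^ N := by
      rcases Nat.even_or_odd N with he | ho
      · rw [he.neg_one_pow]; norm_num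
      · rw [ho.neg_one_pow]
    apply div_pos <;> linarith
  · -- R_N = N + (-1)^N for N ≥ 2: algebraic identity and sign bounds
    have key : ∀ x s : ℝ, 0 < x - 1 → 0 < x + s → (x - 1) / ((x - 1) / (x + s)) = x + s := by
      intro x s h1 _h2
      rw [div_div_eq_mul_div, mul_comm, mul_div_assoc, div_self (ne_of_gt h1), mul_one]
    have hsign : ∀ K : ℕ, (-1 : ℝ) ≤ (-1) ^ K ∧ ((-1 : ℝ) ^ K) ≤ 1 := by
      intro K
      rcases Nat.even_or_odd K with he | ho
      · rw [he.neg_one_pow]; norm_num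
      · rw [ho.neg_one_pow]; norm_num
    refine ⟨3, fun N M hN hM => ?_⟩
    have hN' : (2 : ℝ) ≤ N := by exact_mod_cast hN
    have hM' : (2 : ℝ) ≤ M := by exact_mod_cast hM
    obtain ⟨b1, b1'⟩ := hsign N
    obtain ⟨b2, b2'⟩ := hsign M
    obtain ⟨b3, b3'⟩ := hsign (N + M)
    show ((N : ℝ) - 1) / (((N : ℝ) - 1) / ((N : ℝ) + (-1) ^ N))
        + ((M : ℝ) - 1) / (((M : ℝ) - 1) / ((M : ℝ) + (-1) ^ M)) - 3
        ≤ ((N : ℝ) + (M : ℝ) - 1) / ((((N + M : ℕ) : ℝ) - 1) / (((N + M : ℕ) : ℝ) + (-1) ^ (N + M)))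
    have hc : ((N + M : ℕ) : ℝ) = (N : ℝ) + M := by push_cast; ring
    rw [hc]
    generalize ((-1 : ℝ) ^ N) = s1 at b1 b1' ⊢
    generalize ((-1 : ℝ) ^ M) = s2 at b2 b2' ⊢
    generalize ((-1 : ℝ) ^ (N + M)) = s3 at b3 b3' ⊢
    rw [key (N : ℝ) s1 (by linarith) (by linarith), key (M : ℝ) s2 (by linarith) (by linarith),
      key ((N : ℝ) + M) s3 (by linarith) (by linarith)]
    linarith
  · rintro ⟨B, hB⟩
    -- take N = K even and large: R_K - K * (R_{K+1} - R_K) = (K + 1) - K * (-1) = 2K + 1 > B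
    have hR : ∀ N : ℕ, 2 ≤ N →
        R (fun N => ((N : ℝ) - 1) / ((N : ℝ) + (-1) ^ N)) N = (N : ℝ) + (-1) ^ N := by
      intro N hN
      unfold R
      have hN' : (2 : ℝ) ≤ N := by exact_mod_cast hN
      have h1 : (-1 : ℝ) ≤ (-1) ^ N := by
        rcases Nat.even_or_odd N with he | ho
        · rw [he.neg_one_pow]; norm_num
        · rw [ho.neg_one_pow]
      have hpos : (0 : ℝ) < (N : ℝ) + (-1) ^ N := by linarith
      have hnum : (0 : ℝ) < (N : ℝ) - 1 := by linarith
      rw [div_div_eq_mul_div, mul_comm, mul_div_assoc, div_self (ne_of_gt hnum), mul_one]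
    set K : ℕ := 2 * ⌈|B|⌉₊ + 2 with hKdef
    have hK2 : 2 ≤ K := by omega
    have hKeven : Even K := ⟨⌈|B|⌉₊ + 1, by omega⟩
    have hK1odd : Odd (K + 1) := hKeven.add_one
    have h := hB K K hK2 le_rfl
    unfold incr at h
    rw [hR (K + 1) (by omega), hR K hK2, hKeven.neg_one_pow, hK1odd.neg_one_pow] at h
    push_cast at h
    have hKB : |B| ≤ (⌈|B|⌉₊ : ℝ) := Nat.le_ceil _
    have hKreal : (K : ℝ) = 2 * (⌈|B|⌉₊ : ℝ) + 2 := by rw [hKdef]; push_cast; ring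
    have hBabs : B ≤ |B| := le_abs_self B
    nlinarith

/-! ## §2 S⁺₅ — SUMMABLE INCREMENT DEVIATION: `Σ_n |i_n - ℓ| < ∞` -/

/-- S⁺₅ `IncrementSummable`: the one-site increments deviate summably from a resistivity `ℓ`:
`∃ ℓ S, ∀ N ≥ 2, Σ_{2 ≤ n < N} |i_n - ℓ| ≤ S` (the increment shadow of "summable contact layers",
route SpatialCentreManifold's `LocalFourierLaw`). -/
def IncrementSummable (D : ℕ → ℝ) : Prop :=
  ∃ ℓ S : ℝ, ∀ N : ℕ, 2 ≤ N → ∑ n ∈ Finset.Ico 2 N, |incr D n - ℓ| ≤ S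

/-- Bounded affine deviation `sup_{N ≥ 2} |R_N - ℓN| < ∞` (S⁺₂ of p1-0). -/
def BoundedAffineDeviation (D : ℕ → ℝ) : Prop :=
  ∃ ℓ B : ℝ, ∀ N : ℕ, 2 ≤ N → |R D N - ℓ * N| ≤ B

theorem boundedAffine_of_incrementSummable {D : ℕ → ℝ} (h : IncrementSummable D) :
    BoundedAffineDeviation D := by
  obtain ⟨ℓ, S, hS⟩ := h
  refine ⟨ℓ, S + |R D 2 - ℓ * 2|, fun N hN => ?_⟩
  -- R_N - ℓ N = (R_2 - 2ℓ) + Σ_{2 ≤ n < N} (i_n - ℓ)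
  have htel : ∀ N : ℕ, 2 ≤ N →
      R D N - ℓ * N = (R D 2 - ℓ * 2) + ∑ n ∈ Finset.Ico 2 N, (incr D n - ℓ) := by
    intro N hN
    induction N, hN using Nat.le_induction with
    | base => simp
    | succ n hn ih =>
        rw [Finset.sum_Ico_succ_top hn, ← add_assoc, ← ih]
        unfold incr
        push_cast
        ring
  rw [htel N hN]
  calc |R D 2 - ℓ * 2 + ∑ n ∈ Finset.Ico 2 N, (incr D n - ℓ)|
      ≤ |R D 2 - ℓ * 2| + |∑ n ∈ Finset.Ico 2 N, (incr D n - ℓ)| := abs_add_le _ _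
    _ ≤ |R D 2 - ℓ * 2| + ∑ n ∈ Finset.Ico 2 N, |incr D n - ℓ| := by
        gcongr; exact Finset.abs_sum_le_sum_abs _ _
    _ ≤ |R D 2 - ℓ * 2| + S := by gcongr; exact hS N hN
    _ = S + |R D 2 - ℓ * 2| := by ring

theorem insertionBounded_of_boundedAffine {D : ℕ → ℝ} (h : BoundedAffineDeviation D) :
    InsertionBounded D := by
  obtain ⟨ℓ, B, hB⟩ := h
  rw [insertionBounded_iff_R]
  refine ⟨3 * B, fun N M hN hM => ?_⟩
  have h1 := (abs_le.mp (hB N hN)).2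
  have h2 := (abs_le.mp (hB M hM)).2
  have h3 := (abs_le.mp (hB (N + M) (by omega))).1
  push_cast at h3
  linarith

theorem crux_of_incrementSummable (h : Shell IncrementSummable) :
    Summit.AtomisticToContinuum.FouriersLaw.Theses.JunctionLocality.SuperadditiveResistance :=
  crux_eq_shell.mpr
    (shell_mono (fun _ hD => insertionBounded_of_boundedAffine (boundedAffine_of_incrementSummable hD)) h)

/-! ## §3 NEGATION — what an in-box counterexample must look like: the square-root creep -/

/-- Kill shape for the negation lens: if along the steady-state family the resistance were
`R_N = ℓN + a + b√N` with `b > 0` (finite-size conductivity approaching `κ = 1/ℓ` from BELOW like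
`N^{-1/2}`, the signature of a marginally-scattered long-wave channel / a non-summable boundary
layer), then (A) fails: the doubling excess is `b(2 - √2)√N → ∞`.  Self-contained instance of
`Negative.KillCriteria.not_insertionBounded_of_rpow_correction` (`s = 1/2`). -/
theorem not_insertionBounded_of_sqrt_creep {D : ℕ → ℝ} (ℓ a b : ℝ) (hb : 0 < b)
    (hR : ∀ N : ℕ, 2 ≤ N → R D N = ℓ * N + a + b * Real.sqrt N) :
    ¬ InsertionBounded D := by
  rw [insertionBounded_iff_R]
  rintro ⟨C, hC⟩
  -- doubling at N: 2 R_N - C ≤ R_{2N}, i.e. b (2√N - √(2N)) ≤ C - a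
  have hd : ∀ N : ℕ, 2 ≤ N → b * (2 - Real.sqrt 2) * Real.sqrt N ≤ C - a := by
    intro N hN
    have h := hC N N hN hN
    rw [hR N hN, hR (N + N) (by omega)] at h
    have hs : Real.sqrt ((N + N : ℕ) : ℝ) = Real.sqrt 2 * Real.sqrt N := by
      rw [← Real.sqrt_mul (by norm_num : (0:ℝ) ≤ 2)]
      congr 1; push_cast; ring
    rw [hs] at h
    push_cast at h
    nlinarith
  -- but √N is unbounded
  have hcoef : 0 < b * (2 - Real.sqrt 2) := by
    have : Real.sqrt 2 < 2 := (Real.sqrt_lt' (by norm_num)).mpr (by norm_num)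
    exact mul_pos hb (by linarith)
  -- pick N with √N > (C - a)/(b(2-√2)) : N := ⌈((C - a)/(b(2-√2)))^2⌉₊ + 2
  set x : ℝ := (C - a) / (b * (2 - Real.sqrt 2)) with hx
  set N : ℕ := ⌈x ^ 2⌉₊ + 2 with hNdef
  have hN2 : 2 ≤ N := by omega
  have hNx : x ^ 2 < (N : ℝ) := by
    have h1 : x ^ 2 ≤ (⌈x ^ 2⌉₊ : ℝ) := Nat.le_ceil _
    have h2 : (N : ℝ) = (⌈x ^ 2⌉₊ : ℝ) + 2 := by rw [hNdef]; push_cast; ring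
    linarith
  have hsqrt : x < Real.sqrt N := by
    rcases le_or_gt x 0 with hx0 | hx0
    · exact lt_of_le_of_lt hx0 (Real.sqrt_pos.mpr (by exact_mod_cast (show 0 < N by omega)))
    · calc x = Real.sqrt (x ^ 2) := by rw [Real.sqrt_sq hx0.le]
        _ < Real.sqrt N := Real.sqrt_lt_sqrt (sq_nonneg _) hNx
  have h := hd N hN2
  rw [hx] at hsqrt
  have h' : C - a < Real.sqrt N * (b * (2 - Real.sqrt 2)) := (div_lt_iff₀ hcoef).mp hsqrt
  linarith


/-! ## §4 DECOMPOSITION Σ_h — the geometry split is genuine: balanced pairs do not control lopsided ones -/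

/-- Integer core of the Σ_h independence witness: a spike of height `N₀` at `n = N₀`, a linear tail
`2n - 2N₀` from `n ≥ 3N₀/2` on, zero elsewhere (this is `-b/H` of the census, `R_n = ℓ n + H·spikeC n`). -/
def spikeC (N₀ n : ℕ) : ℤ :=
  if n = N₀ then (N₀ : ℤ) else if 3 * N₀ ≤ 2 * n then 2 * (n : ℤ) - 2 * N₀ else 0

theorem spikeC_nonneg (N₀ n : ℕ) : 0 ≤ spikeC N₀ n := by
  unfold spikeC; split_ifs <;> omega

/-- Superadditivity of the spike profile on every pair `2 ≤ M ≤ N` EXCEPT the lopsided pairs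
`(N₀, M)` with `2M < N₀` (27 linear cases, `omega`). -/
theorem spikeC_superadd {N₀ : ℕ} (hN₀ : 8 ≤ N₀) {N M : ℕ} (hM : 2 ≤ M) (hMN : M ≤ N)
    (hbal : N ≠ N₀ ∨ N₀ ≤ 2 * M) :
    spikeC N₀ N + spikeC N₀ M ≤ spikeC N₀ (N + M) := by
  unfold spikeC; split_ifs <;> omega

/-- … and its failure by exactly `N₀` at the lopsided contact pair `(N₀, 2)`. -/
theorem spikeC_violation {N₀ : ℕ} (hN₀ : 8 ≤ N₀) :
    spikeC N₀ N₀ + spikeC N₀ 2 - spikeC N₀ (N₀ + 2) = N₀ := by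
  unfold spikeC; split_ifs <;> omega

/-- **Σ_h independence witness (single spike).**  For every `N₀ ≥ 8`, `H > 0`, `ℓ > 0` there is a
positive response sequence `D` (`R_n = ℓ n + H·spikeC N₀ n`, eventually affine with slope `ℓ + 2H`)
whose insertion defect `R_N + R_M - R_{N+M}` is `≤ 0` on EVERY pair `2 ≤ M ≤ N` that is balanced
(`N₀ ≤ 2M`, in particular all `N ≤ 2M`) or avoids `N = N₀` — hence (A) with `C = 0` on all balanced pairs —
while the defect at the lopsided contact pair `(N₀, 2)` equals `H·N₀`.  Superposing such spikes at
scales `8^j N₀` with heights `j/N₀^{(j)}` (census §4-s1) gives one sequence satisfying (A) on all balanced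
pairs and violating (A): `Balanced(A) ⇏ (A)`. -/
theorem geometrySplit_independence_witness (N₀ : ℕ) (hN₀ : 8 ≤ N₀) (H ℓ : ℝ) (hH : 0 < H)
    (hℓ : 0 < ℓ) :
    ∃ D : ℕ → ℝ, (∀ n : ℕ, 2 ≤ n → 0 < D n) ∧
      (∀ N M : ℕ, 2 ≤ M → M ≤ N → (N ≠ N₀ ∨ N₀ ≤ 2 * M) → R D N + R D M ≤ R D (N + M)) ∧
      R D N₀ + R D 2 - R D (N₀ + 2) = H * N₀ := by
  set c : ℕ → ℝ := fun n => ((spikeC N₀ n : ℤ) : ℝ) with hc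
  have hc0 : ∀ n, 0 ≤ c n := fun n => by
    simp only [hc]; exact_mod_cast spikeC_nonneg N₀ n
  have hpos : ∀ n : ℕ, 2 ≤ n → 0 < ℓ * n + H * c n := by
    intro n hn
    have hn' : (2 : ℝ) ≤ n := by exact_mod_cast hn
    have h1 : 0 < ℓ * n := mul_pos hℓ (by linarith)
    have h2 : 0 ≤ H * c n := mul_nonneg hH.le (hc0 n)
    linarith
  set D : ℕ → ℝ := fun n => ((n : ℝ) - 1) / (ℓ * n + H * c n) with hD
  have hR : ∀ n : ℕ, 2 ≤ n → R D n = ℓ * n + H * c n := by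
    intro n hn
    simp only [R, hD]
    have hn' : (2 : ℝ) ≤ n := by exact_mod_cast hn
    rw [div_div_eq_mul_div, mul_comm, mul_div_assoc,
      div_self (by linarith : (0 : ℝ) < (n : ℝ) - 1).ne', mul_one]
  refine ⟨D, ?_, ?_, ?_⟩
  · intro n hn
    have hn' : (2 : ℝ) ≤ n := by exact_mod_cast hn
    simp only [hD]
    exact div_pos (by linarith) (hpos n hn)
  · intro N M hM hMN hbal
    rw [hR N (by omega), hR M hM, hR (N + M) (by omega)]
    have key : c N + c M ≤ c (N + M) := by
      simp only [hc]; exact_mod_cast spikeC_superadd hN₀ hM hMN hbal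
    have := mul_le_mul_of_nonneg_left key hH.le
    push_cast
    linarith
  · rw [hR N₀ (by omega), hR 2 le_rfl, hR (N₀ + 2) (by omega)]
    have viol : c N₀ + c 2 - c (N₀ + 2) = (N₀ : ℝ) := by
      simp only [hc]; exact_mod_cast spikeC_violation hN₀
    push_cast
    linear_combination H * viol

end Summit.AtomisticToContinuum.FouriersLaw.Cruxes.SuperadditiveResistance.StrategyCensusS1
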